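import Mathlib
import Summits.KontsevichZagierPeriods.KontsevichZagierPeriods.Theses.IsogenyCertificates
import Literature.NumberTheory.Transcendental.KZRelationsLE
import Literature.NumberTheory.Transcendental.KZSubcalculusInvariants

/-!
# Sketch — crux-ideate stmt-KontsevichZagierPeriods-10663 (`IsogenyCertificates.XMapKernel`), ideator 3

First lemmas of the two idea cards `isogeny-class-collapse` and `unramified-covolume-transfer`,
stated over existing declarations. PROVED here (no sorry): `xmapKernel_iff` (the generating set
`Gens` is a verbatim copy of the crux's, `Iff.rfl`), `relations_le_relationsX`, `scale_mem_XRel`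
(the relator set is stable under positive rational integrand scaling), `torsionFree_relationsX`
(`FormalRep ⧸ closure(M ∪ X)` is torsion-free — the hinge of card 1), `covol_integrand_identity`
(the pointwise rule-2 identity of card 2 from the complex datum identity). Stubs (`sorry`, the
lines' genuine first lemmas): `sectorCollapse`, `rankHinge`, `covolumeSheetTransfer`,
`covolumeClassKernel`.
-/

noncomputable section

set_option linter.dupNamespace false

namespace Summit.KontsevichZagierPeriods.KontsevichZagierPeriods.Cruxes.XMapKernel.Ideator3

open Literature.NumberTheory.Transcendental Polynomial MeasureTheory

/-! ## The crux's generating set, named -/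

/-- An x-rational isogeny datum `(f, g, c)` from `y² = x³ + Ax + B` to `y² = x³ + A'x + B'`
(verbatim the two datum conjuncts of `XMapKernel`). -/
def IsXDatum (A B A' B' : ℤ) (f g : ℚ[X]) (c : ℚ) : Prop :=
  derivative f * g - f * derivative g ≠ 0 ∧
    C (c ^ 2) * g * (f ^ 3 + C (A' : ℚ) * f * g ^ 2 + C (B' : ℚ) * g ^ 3) =
      (X ^ 3 + C (A : ℚ) * X + C (B : ℚ)) * (derivative f * g - f * derivative g) ^ 2

/-- A representation of the SECTOR shape `[{P > 0}, a/√P]`, `P = x³ + Ax + B` nonsingular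
integral, `a > 0` rational (verbatim the shape clauses of `XMapKernel`). -/
def IsSectorRep (A B : ℤ) (a : ℚ) (r : KZ.IntegralRep 1) : Prop :=
  4 * A ^ 3 + 27 * B ^ 2 ≠ 0 ∧ 0 < a ∧
    r.domain = {x | 0 < x 0 ^ 3 + (A : ℝ) * x 0 + (B : ℝ)} ∧
    Set.EqOn r.integrand (fun x => (a : ℝ) / Real.sqrt (x 0 ^ 3 + (A : ℝ) * x 0 + (B : ℝ))) r.domain

/-- The x-map relator set `X` of the crux. -/
def XRel : Set KZ.FormalRep :=
  {d | ∃ (A B A' B' : ℤ) (f g : ℚ[X]) (c a b : ℚ) (r r' : KZ.IntegralRep 1),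
    4 * A ^ 3 + 27 * B ^ 2 ≠ 0 ∧ 4 * A' ^ 3 + 27 * B' ^ 2 ≠ 0 ∧
    derivative f * g - f * derivative g ≠ 0 ∧
    C (c ^ 2) * g * (f ^ 3 + C (A' : ℚ) * f * g ^ 2 + C (B' : ℚ) * g ^ 3) =
      (X ^ 3 + C (A : ℚ) * X + C (B : ℚ)) * (derivative f * g - f * derivative g) ^ 2 ∧
    0 < a ∧ 0 < b ∧
    r.domain = {x | 0 < x 0 ^ 3 + (A : ℝ) * x 0 + (B : ℝ)} ∧
    Set.EqOn r.integrand (fun x => (a : ℝ) / Real.sqrt (x 0 ^ 3 + (A : ℝ) * x 0 + (B : ℝ))) r.domain ∧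
    r'.domain = {x | 0 < x 0 ^ 3 + (A' : ℝ) * x 0 + (B' : ℝ)} ∧
    Set.EqOn r'.integrand (fun x => (b : ℝ) / Real.sqrt (x 0 ^ 3 + (A' : ℝ) * x 0 + (B' : ℝ))) r'.domain ∧
    r.value = r'.value ∧ d = KZ.of r - KZ.of r'}

/-- The four move sets. -/
def Moves : Set KZ.FormalRep :=
  KZ.domainAddRel ∪ KZ.integrandAddRel ∪ KZ.changeOfVariablesRel ∪ KZ.newtonLeibnizRel

/-- The crux's generating set `M ∪ X` and the enlarged relation subgroup `R⁺`. -/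
def Gens : Set KZ.FormalRep := Moves ∪ XRel

/-- `R⁺ = closure (M ∪ X)`. -/
def relationsX : AddSubgroup KZ.FormalRep := AddSubgroup.closure Gens

/-- CHECK: the crux is literally `ker eval ≤ R⁺` for the sets named above. -/
theorem xmapKernel_iff :
    Theses.IsogenyCertificates.XMapKernel ↔
      ∀ c : KZ.FormalRep, KZ.eval c = 0 → c ∈ relationsX :=
  Iff.rfl

/-- `relations ≤ R⁺` (the enlarged calculus contains the calculus). -/
theorem relations_le_relationsX : KZ.relations ≤ relationsX :=
  AddSubgroup.closure_mono Set.subset_union_left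

/-! ## Card `isogeny-class-collapse` -/

/-- The real period `Ω(A,B) = ∫_{P>0} dx/√P` of `y² = x³ + Ax + B`. -/
def realPeriod (E : ℤ × ℤ) : ℝ :=
  ∫ x in {x : Fin 1 → ℝ | 0 < x 0 ^ 3 + (E.1 : ℝ) * x 0 + (E.2 : ℝ)},
    1 / Real.sqrt (x 0 ^ 3 + (E.1 : ℝ) * x 0 + (E.2 : ℝ))

/-- `E` is joined to `E'` by an x-rational isogeny datum of the crux's shape. -/
def XConn (E E' : ℤ × ℤ) : Prop := ∃ (f g : ℚ[X]) (c : ℚ), IsXDatum E.1 E.2 E'.1 E'.2 f g c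

/-- x-isogeny CLASSES: the equivalence relation generated by `XConn`. -/
def XClass : ℤ × ℤ → ℤ × ℤ → Prop := Relation.EqvGen XConn

/-- The sector span: the subgroup generated by all sector representations. -/
def sectorSpan : AddSubgroup KZ.FormalRep :=
  AddSubgroup.closure {d | ∃ (A B : ℤ) (a : ℚ) (r : KZ.IntegralRep 1), IsSectorRep A B a r ∧ d = KZ.of r}

/-- (S) sector representations exist for every admissible `(A, B, a)` (routine real analysis:
`{P>0}` is `ℚ`-semialgebraic, `a/√P` is `ℚ`-semialgebraic on it and absolutely integrable). -/
def SectorRepsExist : Prop :=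
  ∀ (A B : ℤ) (a : ℚ), 4 * A ^ 3 + 27 * B ^ 2 ≠ 0 → 0 < a →
    ∃ r : KZ.IntegralRep 1, IsSectorRep A B a r

/-- (V) the VALUE half of the relator mechanism, no moves: an x-rational isogeny datum forces a
positive RATIONAL ratio of real periods (sheet count over `|c|`). -/
def XValueRatio : Prop :=
  ∀ (E E' : ℤ × ℤ), 4 * E.1 ^ 3 + 27 * E.2 ^ 2 ≠ 0 → 4 * E'.1 ^ 3 + 27 * E'.2 ^ 2 ≠ 0 →
    XConn E E' → ∃ ρ : ℚ, 0 < ρ ∧ realPeriod E = (ρ : ℝ) * realPeriod E'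

/-- (R) RIGIDITY across x-isogeny classes (Huber–Wüstholz Thm 15.3 / Prop. 16.5 for
`[ℤ → 𝔾ₘ] × E₁ × ⋯ × E_k` + Schneider/twist bookkeeping, INLINED as a hypothesis in the style of
`HermiteRigidity.RigidKernel`): real periods of pairwise x-isogeny-inequivalent nonsingular
integral curves are `ℚ`-linearly independent. -/
def XClassRigidity : Prop :=
  ∀ (k : ℕ) (E : Fin k → ℤ × ℤ), (∀ i, 4 * (E i).1 ^ 3 + 27 * (E i).2 ^ 2 ≠ 0) →
    (∀ i j, i ≠ j → ¬ XClass (E i) (E j)) →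
    ∀ q : Fin k → ℚ, ∑ i, (q i : ℝ) * realPeriod (E i) = 0 → ∀ i, q i = 0

/-- FIRST LEMMA of card `isogeny-class-collapse` (bookkeeping only; provable now): under (S), (V),
(R) every vanishing `ℤ`-combination supported on the elliptic real-period sector lies in
`R⁺ = closure (M ∪ X)` — the relators collapse each x-isogeny class of the sector quotient to ONE
`ℚ`-line (all rational weights `a, b` are in `X`, so no torsion arises), and (R) says `eval` is
injective on the collapsed quotient. Uses of `Gens`: integrand additivity (same-curve merging,
zero reps), domain additivity (null reps) and `XRel`; no change of variables, no Newton–Leibniz. -/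
theorem sectorCollapse (hS : SectorRepsExist) (hV : XValueRatio) (hR : XClassRigidity) :
    ∀ c ∈ sectorSpan, KZ.eval c = 0 → c ∈ relationsX := by
  sorry

/-- The relator set is stable under scaling the integrand by a positive rational (rational
weights `a ↦ q a`, `b ↦ q b`; values scale together). -/
theorem scale_mem_XRel (q : ℚ) (hq : 0 < q) {x : KZ.FormalRep} (hx : x ∈ XRel) :
    KZ.scale (q : ℝ) (isAlgebraic_algebraMap q) x ∈ XRel := by
  obtain ⟨A, B, A', B', f, g, c, a, b, r, r', hΔ, hΔ', hW, hI, ha, hb, h1, h2, h3, h4, h5, rfl⟩ := hx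
  refine ⟨A, B, A', B', f, g, c, q * a, q * b, r.constMul _ (isAlgebraic_algebraMap q),
    r'.constMul _ (isAlgebraic_algebraMap q), hΔ, hΔ', hW, hI, mul_pos hq ha, mul_pos hq hb, h1, ?_, h3, ?_,
    ?_, by simp [map_sub]⟩
  · intro x hx
    have hx' : x ∈ r.domain := hx
    simp only [KZ.IntegralRep.integrand_constMul, h2 hx', eq_ratCast]
    push_cast
    ring
  · intro x hx
    have hx' : x ∈ r'.domain := hx
    simp only [KZ.IntegralRep.integrand_constMul, h4 hx', eq_ratCast]
    push_cast
    ring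
  · simp [h5]

/-- TORSION-FREENESS of `FormalRep ⧸ R⁺` (provable now from `KZ.scale (1/n)`,
`KZ.scale_mem_relations`, `scale_mem_XRel` and `KZ.IntegralRep.of_constMul_nat_sub_nsmul_mem_relations`):
the hinge turning a RANK count on any finitely generated piece into membership. -/
theorem torsionFree_relationsX (n : ℕ) (hn : 0 < n) (c : KZ.FormalRep) (h : n • c ∈ relationsX) :
    c ∈ relationsX := by
  -- the scaling endomorphism by `1/n`
  have hq : (0 : ℚ) < 1 / n := by positivity
  set s : KZ.FormalRep →+ KZ.FormalRep := KZ.scale ((1 / n : ℚ) : ℝ) (isAlgebraic_algebraMap (1 / n : ℚ)) with hs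
  -- (1) `s` preserves the generating set, hence `R⁺`
  have hGens : ∀ x ∈ Gens, s x ∈ Gens := by
    rintro x (hx | hx)
    · exact Or.inl (KZ.scale_mem_moves _ _ hx)
    · exact Or.inr (scale_mem_XRel (1 / n) hq hx)
  have hR : ∀ x ∈ relationsX, s x ∈ relationsX := by
    intro x hx
    have hle : relationsX ≤ relationsX.comap s :=
      (AddSubgroup.closure_le _).mpr fun y hy => AddSubgroup.subset_closure (hGens y hy)
    exact hle hx
  -- (2) `n • s d − d ∈ relations` for every `d` (integer scaling is integrand additivity)
  have hT : ∀ d : KZ.FormalRep, n • s d - d ∈ KZ.relations := by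
    intro d
    induction d using FreeAbelianGroup.induction_on with
    | zero => simp [KZ.relations.zero_mem]
    | of x =>
      obtain ⟨k, r⟩ := x
      change n • s (KZ.of r) - KZ.of r ∈ KZ.relations
      rw [hs, KZ.scale_of]
      have hrr : (r.constMul ((1 / n : ℚ) : ℝ) (isAlgebraic_algebraMap (1 / n : ℚ))).constMul (n : ℝ)
          (isAlgebraic_nat n) = r := by
        cases r with
        | mk dom f hd hf hi =>
          simp only [KZ.IntegralRep.constMul, KZ.IntegralRep.mk.injEq, true_and]
          funext x
          have hn' : (n : ℝ) ≠ 0 := by exact_mod_cast hn.ne'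
          push_cast
          field_simp
      have h1 := (r.constMul ((1 / n : ℚ) : ℝ) (isAlgebraic_algebraMap (1 / n : ℚ))).of_constMul_nat_sub_nsmul_mem_relations n
      rw [hrr] at h1
      -- h1 : of r - n • of (r/n) ∈ relations
      have := KZ.relations.neg_mem h1
      simpa [neg_sub] using this
    | neg x hx =>
      obtain ⟨k, r⟩ := x
      have : n • s (-FreeAbelianGroup.of (⟨k, r⟩ : Σ m, KZ.IntegralRep m)) - -FreeAbelianGroup.of ⟨k, r⟩ =
          -(n • s (FreeAbelianGroup.of ⟨k, r⟩) - FreeAbelianGroup.of ⟨k, r⟩) := by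
        simp [map_neg, smul_neg]; abel
      rw [this]
      exact KZ.relations.neg_mem hx
    | add x y hx hy =>
      have : n • s (x + y) - (x + y) = (n • s x - x) + (n • s y - y) := by
        simp [map_add, smul_add]; abel
      rw [this]
      exact KZ.relations.add_mem hx hy
  -- (3) assemble: `c = n • s c − (n • s c − c)`
  have h2 : n • s c ∈ relationsX := by
    rw [← map_nsmul]
    exact hR _ h
  have h3 : n • s c - c ∈ relationsX := relations_le_relationsX (hT c)
  have : c = n • s c - (n • s c - c) := by abel
  rw [this]
  exact relationsX.sub_mem h2 h3

/-- THE HINGE (pure algebra, provable now): if a finitely generated `F ≤ FormalRep` carries at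
least `rank (ker eval ⊓ F)` independent elements of `R⁺` — stated through `ℚ`-dimensions of the
coefficient images — then `ker eval ⊓ F ≤ R⁺`. Stated for a finite family of generators `v`. -/
theorem rankHinge (k : ℕ) (v : Fin k → KZ.FormalRep)
    (ρ : Fin k → KZ.FormalRep) (hρ : ∀ i, ρ i ∈ relationsX)
    (M : Matrix (Fin k) (Fin k) ℤ) (hM : ∀ i, ρ i = ∑ j, M i j • v j)
    (hrank : Module.finrank ℚ (Submodule.span ℚ (Set.range fun i => fun j => ((M i j : ℤ) : ℚ))) +
      Module.finrank ℚ (Submodule.span ℚ (Set.range fun i : Fin k => (KZ.eval (v i) : ℝ))) ≥ k) :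
    ∀ n : Fin k → ℤ, KZ.eval (∑ i, n i • v i) = 0 → (∑ i, n i • v i) ∈ relationsX := by
  sorry

/-! ## Card `unramified-covolume-transfer` -/

/-- The COVOLUME representation shape: `[{z ∈ ℂ ≅ ℝ² : P(z) ≠ 0}, a/|P(z)|]`, `P = z³ + Az + B`
read as a polynomial over `ℂ` (value `a · C(E)`, `C(E) = ∬ dA/|P| = ½ covol Λ_{dx/y}`). Complex
coefficients `A, B` are allowed: every `ℚ̄`-isogenous curve has such a representation, with
real-algebraic data (real and imaginary parts). -/
def IsCovolRep (A B : ℂ) (a : ℝ) (r : KZ.IntegralRep 2) : Prop :=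
  r.domain = {p | ((p 0 : ℂ) + (p 1 : ℂ) * Complex.I) ^ 3 + A * ((p 0 : ℂ) + (p 1 : ℂ) * Complex.I) + B ≠ 0} ∧
    Set.EqOn r.integrand
      (fun p => a / ‖((p 0 : ℂ) + (p 1 : ℂ) * Complex.I) ^ 3 + A * ((p 0 : ℂ) + (p 1 : ℂ) * Complex.I) + B‖)
      r.domain

/-- A COMPLEX x-rational isogeny datum in standard form: the crux's datum identity base-changed
to `ℂ`, with `deg f = ℓ > deg g`, `f, g` coprime (so `R = f/g` has degree `ℓ` and is `ℓ`-to-one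
off its finitely many critical values). -/
def IsComplexXDatum (A B A' B' : ℂ) (f g : ℂ[X]) (c : ℂ) (ℓ : ℕ) : Prop :=
  0 < ℓ ∧ f.natDegree = ℓ ∧ g.natDegree < ℓ ∧ IsCoprime f g ∧
    C (c ^ 2) * g * (f ^ 3 + C A' * f * g ^ 2 + C B' * g ^ 3) =
      (X ^ 3 + C A * X + C B) * (derivative f * g - f * derivative g) ^ 2

/-- FIRST LEMMA of card `unramified-covolume-transfer`: an `ℓ`-sheeted complex x-map transfers the
covolume representation with the RULE-2 integrand identity `a/|P| = (a/|c|²)·|R′|²/|P′∘R|` on the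
nose and CONSTANT sheet count `ℓ` (no eggs, no 2-torsion step, no reality condition on the
isogeny): `[ℂ, a/|P|] − [ℂ, (ℓ a/|c|²)/|P′|] ∈ KZ.relations` (hence `∈ R⁺`). Data: real and
imaginary parts of `A, B, A', B', c` and of the coefficients of `f, g` real algebraic (automatic
for isogenies between curves over `ℚ̄`), so that all sheets are `ℚ`-semialgebraic. -/
theorem covolumeSheetTransfer (A B A' B' : ℂ) (f g : ℂ[X]) (c : ℂ) (ℓ : ℕ)
    (hD : IsComplexXDatum A B A' B' f g c ℓ)
    (halg : ∀ z ∈ ({A, B, A', B', c} ∪ {w | ∃ n, w = f.coeff n ∨ w = g.coeff n} : Set ℂ),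
      IsAlgebraic ℚ z.re ∧ IsAlgebraic ℚ z.im)
    (a : ℝ) (ha : IsAlgebraic ℚ a) (r r' : KZ.IntegralRep 2)
    (hr : IsCovolRep A B a r) (hr' : IsCovolRep A' B' (ℓ * a / ‖c‖ ^ 2) r') :
    KZ.of r - KZ.of r' ∈ KZ.relations := by
  sorry

/-- The datum identity pins the Jacobian: pointwise, wherever `g z ≠ 0`, `P z ≠ 0` and `W z ≠ 0`
(off the poles of `R`, the three punctures and the finitely many critical points — a null set), we
have `c ≠ 0`, `P'(R z) ≠ 0` and `1/‖P z‖ = ‖R' z‖² / (‖c‖² · ‖P'(R z)‖)` with `R = f/g`, `R' = W/g²`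
— the rule-2 integrand identity for the real map `z ↦ R z` on `ℝ² = ℂ`, whose real Jacobian
determinant is `‖R' z‖²` (Cauchy–Riemann). Elementary algebra from `IsComplexXDatum`; PROVED. -/
theorem covol_integrand_identity (A B A' B' : ℂ) (f g : ℂ[X]) (c : ℂ) (ℓ : ℕ)
    (hD : IsComplexXDatum A B A' B' f g c ℓ) (z : ℂ)
    (hg : g.eval z ≠ 0) (hP : (z ^ 3 + A * z + B) ≠ 0)
    (hW : (derivative f * g - f * derivative g).eval z ≠ 0) :
    let R : ℂ := f.eval z / g.eval z
    let R' : ℂ := (derivative f * g - f * derivative g).eval z / (g.eval z) ^ 2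
    c ≠ 0 ∧ R ^ 3 + A' * R + B' ≠ 0 ∧
      1 / ‖z ^ 3 + A * z + B‖ = ‖R'‖ ^ 2 / (‖c‖ ^ 2 * ‖R ^ 3 + A' * R + B'‖) := by
  obtain ⟨-, -, -, -, hI⟩ := hD
  -- evaluate the polynomial identity at `z`
  have h := congrArg (Polynomial.eval z) hI
  simp only [eval_mul, eval_add, eval_pow, eval_C, eval_X] at h
  set fz := f.eval z with hfz
  set gz := g.eval z with hgz
  set Wz := (derivative f * g - f * derivative g).eval z with hWz
  -- h : c ^ 2 * gz * (fz ^ 3 + A' * fz * gz ^ 2 + B' * gz ^ 3) = (z ^ 3 + A * z + B) * Wz ^ 2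
  have hN : fz ^ 3 + A' * fz * gz ^ 2 + B' * gz ^ 3 ≠ 0 := by
    intro h0
    rw [h0, mul_zero] at h
    exact mul_ne_zero hP (pow_ne_zero 2 hW) h.symm
  have hc : c ≠ 0 := by
    intro h0
    rw [h0] at h
    simp only [ne_eq, OfNat.ofNat_ne_zero, not_false_eq_true, zero_pow, zero_mul] at h
    exact mul_ne_zero hP (pow_ne_zero 2 hW) h.symm
  intro R R'
  have hR : R ^ 3 + A' * R + B' = (fz ^ 3 + A' * fz * gz ^ 2 + B' * gz ^ 3) / gz ^ 3 := by
    simp only [R]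
    field_simp
  have hR0 : R ^ 3 + A' * R + B' ≠ 0 := by
    rw [hR]
    exact div_ne_zero hN (pow_ne_zero 3 hg)
  refine ⟨hc, hR0, ?_⟩
  -- norms of both sides of `h`
  have hn := congrArg (fun w : ℂ => ‖w‖) h
  simp only [norm_mul, norm_pow] at hn
  have hgz0 : ‖gz‖ ≠ 0 := norm_ne_zero_iff.mpr hg
  have hc0 : ‖c‖ ≠ 0 := norm_ne_zero_iff.mpr hc
  have hP0 : ‖z ^ 3 + A * z + B‖ ≠ 0 := norm_ne_zero_iff.mpr hP
  have hN0 : ‖fz ^ 3 + A' * fz * gz ^ 2 + B' * gz ^ 3‖ ≠ 0 := norm_ne_zero_iff.mpr hN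
  rw [hR]
  simp only [R', norm_div, norm_pow]
  set nP := ‖z ^ 3 + A * z + B‖ with hnP
  set nN := ‖fz ^ 3 + A' * fz * gz ^ 2 + B' * gz ^ 3‖ with hnN
  set nW := ‖Wz‖ with hnW
  set ng := ‖gz‖ with hng
  set nc := ‖c‖ with hnc
  -- hn : nc ^ 2 * ng * nN = nP * nW ^ 2 ; all atoms are non-zero reals
  rw [div_eq_div_iff hP0 (mul_ne_zero (pow_ne_zero 2 hc0) (div_ne_zero hN0 (pow_ne_zero 3 hgz0)))]
  field_simp
  linear_combination hn

/-- IN-CLASS COVOLUME KERNEL (the sector this engine closes with NO transcendence input): for a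
finite family of curves each joined to a base curve `E₀` by a complex x-datum, every vanishing
`ℤ`-combination of their covolume representations (real-algebraic weights) is a KZ relation —
values are real-algebraic multiples `ℓ/|c|²` of `C(E₀)`, and algebraic proportionality IS
integrand rescaling. Conditional only on the transfer lemma and on existence of the reps. -/
theorem covolumeClassKernel (k : ℕ) (A B : Fin (k + 1) → ℂ)
    (f g : Fin k → ℂ[X]) (c : Fin k → ℂ) (ℓ : Fin k → ℕ)
    (hD : ∀ i : Fin k, IsComplexXDatum (A 0) (B 0) (A i.succ) (B i.succ) (f i) (g i) (c i) (ℓ i))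
    (hT : ∀ (i : Fin k) (a : ℝ), IsAlgebraic ℚ a → ∀ r r' : KZ.IntegralRep 2,
      IsCovolRep (A 0) (B 0) a r → IsCovolRep (A i.succ) (B i.succ) (ℓ i * a / ‖c i‖ ^ 2) r' →
      KZ.of r - KZ.of r' ∈ KZ.relations)
    (hE : ∀ (i : Fin (k + 1)) (a : ℝ), IsAlgebraic ℚ a → ∃ r : KZ.IntegralRep 2, IsCovolRep (A i) (B i) a r)
    (hC : (∫ p in {p : Fin 2 → ℝ | ((p 0 : ℂ) + (p 1 : ℂ) * Complex.I) ^ 3 + A 0 * ((p 0 : ℂ) + (p 1 : ℂ) * Complex.I) + B 0 ≠ 0},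
      1 / ‖((p 0 : ℂ) + (p 1 : ℂ) * Complex.I) ^ 3 + A 0 * ((p 0 : ℂ) + (p 1 : ℂ) * Complex.I) + B 0‖) ≠ 0) :
    ∀ c' ∈ AddSubgroup.closure {d : KZ.FormalRep | ∃ (i : Fin (k + 1)) (a : ℝ) (r : KZ.IntegralRep 2),
        IsAlgebraic ℚ a ∧ IsCovolRep (A i) (B i) a r ∧ d = KZ.of r},
      KZ.eval c' = 0 → c' ∈ KZ.relations := by
  sorry

end Summit.KontsevichZagierPeriods.KontsevichZagierPeriods.Cruxes.XMapKernel.Ideator3
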